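import Summits.CriticalPhenomena.PercolationContinuityZ3.Theorems.PercNearOneGluingNoHeavyPcintChordDiagrams
import HarnessLib

/-!
# CriticalPhenomena/PercolationContinuityZ3 — Theorems/PercNearOneGluingNoHeavyPcintChordDiagramDecomp.lean: IRREDUCIBLE CHORD DIAGRAMS — the last-chord / maximal-block DECOMPOSITION and the fibre count (combinatorial core of STRUCTURE law C5-L1, part 2)

Lane prim-pcint, STRUCTURE rule «numerics ⇒ structure ⇒ conjecture» (prim-pcint-2 GEN 20); sequel of …PcintChordDiagrams.
THE DECOMPOSITION.  Let `π` be an irreducible chord diagram (`IsGood`) on a finite linear order `α` with at least three points, bottom `b` and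
top `z`, and let `R = rmax π b z` be the LARGEST candidate (the union of all convex `R'` avoiding `b`, `z` and the point above, containing the
partner `π z`, with `R' ∪ {z}` closed; it is itself a candidate, `rmax_isCand`).  Then
* `π` restricted to `R ∪ {z}` is irreducible (`isGood_restr_rmax`) and `π` restricted to the complement is irreducible
  (`isGood_restr_compl_rmax`) — maximality of `R` is what makes the outer part irreducible;
* conversely, gluing irreducible diagrams on `(R ∪ {z})ᶜ` and `R ∪ {z}` along ANY shape `R` gives an irreducible diagram (gluing lemma of part 1)
  whose largest candidate is `R` again (`rmax_glue`);
* hence the FIBRE COUNT `card_goodSet_eq_sum`: `#Irr(α) = Σ_{R shape} #Irr((R ∪ {z})ᶜ) · #Irr(R ∪ {z})`.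
On `Fin 2n` the shapes of size `2(n−k)−1` number `2k−1`, so this is the Touchard–Riordan / Stein / Nijenhuis–Wilf recurrence
`a(n) = Σ_k (2k−1) a(k) a(n−k) = (n−1) Σ_k a(k) a(n−k)` for connected chord diagrams (the arithmetic is done in …PcintChordDiagramCount).
In words: cut an irreducible diagram at its last chord `(j, z)`; the other chords split into the OUTERMOST component `A` (irreducible, `k` chords)
and everything nested in the gap of `A` containing `j` (with the last chord: irreducible, `n − k` chords); the gap is one of the `2k − 1` inner gaps.

HONEST FRAMING: elementary finite combinatorics written for the proof of `polygonLeadingCoeffLaw` (all `m`); the bijection was machine-checked for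
`n ≤ 6` before typing (gen 20 work/num/decomp_check.py).  No `sorry`; standard axioms.  Sources as in part 1 (Touchard 1952, Riordan 1975, Stein 1978,
Nijenhuis–Wilf 1979, Flajolet–Noy 2000; the decomposition via the maximal block is ours).  Written by prim-pcint-2 gen 20, 2026-08-26.
-/

namespace Summit.CriticalPhenomena.PercolationContinuityZ3.Theorems.Pcint.ChordDiag

variable {α : Type*} [LinearOrder α] [Fintype α]

/-! ### The largest candidate and the two parts -/

section Top

variable {π : α → α} {b z : α}

/-- **The largest candidate is a candidate** (irreducible `π`, at least three points). [folklore] -/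
theorem rmax_isCand (hg : IsGood π) (hb : ∀ x, b ≤ x) (hz : ∀ x, x ≤ z) (h3 : 3 ≤ Fintype.card α) :
    IsCand π b z (rmax π b z) := by
  have key : rmax π b z = ∅ ∨ IsCand π b z (rmax π b z) := by
    unfold rmax
    refine Finset.sup_induction (p := fun R => R = ∅ ∨ IsCand π b z R) (Or.inl rfl) ?_ ?_
    · rintro R₁ (rfl | h₁) R₂ (rfl | h₂)
      · exact Or.inl (by simp)
      · exact Or.inr (by simpa using h₂)
      · exact Or.inr (by simpa using h₁)
      · exact Or.inr (h₁.union h₂)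
    · intro R hR
      exact Or.inr (mem_candSet.1 hR)
  rcases key with h0 | h
  · have := subset_rmax (isCand_singleton hg hb hz h3) (Finset.mem_singleton_self (π z))
    rw [h0] at this
    exact absurd this (Finset.notMem_empty _)
  · exact h

/-- The shape of the largest candidate. [folklore] -/
theorem rmax_mem_shapeSet (hg : IsGood π) (hb : ∀ x, b ≤ x) (hz : ∀ x, x ≤ z) (h3 : 3 ≤ Fintype.card α) :
    rmax π b z ∈ shapeSet b z :=
  mem_shapeSet.2 (rmax_isCand hg hb hz h3).1

/-- **The inner part is irreducible**: `π` restricted to `rmax ∪ {z}`. [folklore] -/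
theorem isGood_restr_rmax (hg : IsGood π) (hb : ∀ x, b ≤ x) (hz : ∀ x, x ≤ z) (h3 : 3 ≤ Fintype.card α) :
    IsGood (restr π (insert z (rmax π b z))) := by
  set R := rmax π b z with hRdef
  obtain ⟨⟨hRne, hRc, hzR, hbR, u, huR, huz, hu⟩, hjR, hScl⟩ := rmax_isCand hg hb hz h3
  set S := insert z R with hSdef
  have hd := hg.1
  refine ⟨hd.restr hScl, fun J hJc hJcl => ?_⟩
  by_contra hJ
  rw [not_or] at hJ
  obtain ⟨hJ0, hJ1⟩ := hJ
  -- the image `J'` of `J` in `α`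
  set J' : Finset α := J.map (Function.Embedding.subtype _) with hJ'
  have memJ' : ∀ {t : α}, t ∈ J' ↔ ∃ h : t ∈ S, (⟨t, h⟩ : ↥S) ∈ J := fun {t} => by
    rw [hJ', Finset.mem_map]
    constructor
    · rintro ⟨⟨t', ht'⟩, hJt, rfl⟩; exact ⟨ht', hJt⟩
    · rintro ⟨ht, hJt⟩; exact ⟨⟨t, ht⟩, hJt, rfl⟩
  have hJ'S : ∀ {t : α}, t ∈ J' → t ∈ S := fun ht => (memJ'.1 ht).1
  have hJ'cl : Closed π J' := fun t ht => by
    obtain ⟨hts, hJt⟩ := memJ'.1 ht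
    have := hJcl hJt
    have hv : ((restr π S ⟨t, hts⟩ : ↥S) : α) = π t := restr_val hScl _
    exact memJ'.2 ⟨hScl hts, by convert this using 1; exact Subtype.ext hv.symm⟩
  obtain ⟨⟨s₀, hs₀S⟩, hs₀⟩ := Finset.nonempty_iff_ne_empty.2 hJ0
  by_cases hzJ : (⟨z, Finset.mem_insert_self z R⟩ : ↥S) ∈ J
  · -- `z ∈ J`: the complement `C = S ∖ J'` is a proper non-empty block of `π`
    have hzJ' : z ∈ J' := memJ'.2 ⟨_, hzJ⟩
    set C : Finset α := S \ J' with hC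
    have hCcl : Closed π C := hd.closed_sdiff hScl hJ'cl
    have hCc : Convex C := by
      intro x hx y hy t hxt hty
      rw [hC, Finset.mem_sdiff] at hx hy ⊢
      have hyz : y ≠ z := fun h => hy.2 (h ▸ hzJ')
      have hxz : x ≠ z := fun h => hx.2 (h ▸ hzJ')
      have hyR : y ∈ R := by simpa [hSdef, hyz] using hy.1
      have hxR : x ∈ R := by simpa [hSdef, hxz] using hx.1
      have htR : t ∈ R := hRc hxR hyR hxt hty
      have htS : t ∈ S := Finset.mem_insert_of_mem htR
      refine ⟨htS, fun htJ' => hy.2 ?_⟩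
      -- `J` is convex in `S` and contains `t ≤ y ≤ z`
      obtain ⟨_, htJ⟩ := memJ'.1 htJ'
      exact memJ'.2 ⟨hy.1, hJc htJ hzJ (show (⟨t, htS⟩ : ↥S) ≤ ⟨y, hy.1⟩ from hty) (show (⟨y, hy.1⟩ : ↥S) ≤ ⟨z, _⟩ from hz y)⟩
    rcases hg.2 C hCc hCcl with h0 | h1
    · -- `C` non-empty since `J ≠ univ`
      obtain ⟨⟨s, hsS⟩, hsJ⟩ : ∃ s : ↥S, s ∉ J := by
        by_contra h; push Not at h
        exact hJ1 (Finset.eq_univ_iff_forall.2 h)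
      have : s ∈ C := by
        rw [hC, Finset.mem_sdiff]
        exact ⟨hsS, fun h => hsJ (by obtain ⟨h', hJ⟩ := memJ'.1 h; exact hJ)⟩
      rw [h0] at this; exact Finset.notMem_empty _ this
    · have : z ∈ C := Finset.eq_univ_iff_forall.1 h1 _
      rw [hC, Finset.mem_sdiff] at this
      exact this.2 hzJ'
  · -- `z ∉ J`: `J'` itself is a proper non-empty block of `π` inside `R`
    have hzJ' : z ∉ J' := fun h => by obtain ⟨_, h⟩ := memJ'.1 h; exact hzJ h
    have hJ'R : ∀ {t : α}, t ∈ J' → t ∈ R := fun {t} ht => by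
      have hts := hJ'S ht
      rw [hSdef, Finset.mem_insert] at hts
      rcases hts with rfl | h
      · exact absurd ht hzJ'
      · exact h
    have hJ'c : Convex J' := by
      intro x hx y hy t hxt hty
      have htR : t ∈ R := hRc (hJ'R hx) (hJ'R hy) hxt hty
      have htS : t ∈ S := Finset.mem_insert_of_mem htR
      obtain ⟨hxS, hxJ⟩ := memJ'.1 hx
      obtain ⟨hyS, hyJ⟩ := memJ'.1 hy
      exact memJ'.2 ⟨htS, hJc hxJ hyJ (show (⟨x, hxS⟩ : ↥S) ≤ ⟨t, htS⟩ from hxt) (show (⟨t, htS⟩ : ↥S) ≤ ⟨y, hyS⟩ from hty)⟩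
    rcases hg.2 J' hJ'c hJ'cl with h0 | h1
    · have : s₀ ∈ J' := memJ'.2 ⟨hs₀S, hs₀⟩
      rw [h0] at this; exact Finset.notMem_empty _ this
    · exact hzJ' (Finset.eq_univ_iff_forall.1 h1 _)

/-- **The outer part is irreducible**: `π` restricted to the complement of `rmax ∪ {z}`. [folklore] -/
theorem isGood_restr_compl_rmax (hg : IsGood π) (hb : ∀ x, b ≤ x) (hz : ∀ x, x ≤ z) (h3 : 3 ≤ Fintype.card α) :
    IsGood (restr π (insert z (rmax π b z))ᶜ) := by
  set R := rmax π b z with hRdef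
  have hRcand := rmax_isCand hg hb hz h3
  obtain ⟨⟨hRne, hRc, hzR, hbR, u, huR, huz, hu⟩, hjR, hScl⟩ := hRcand
  set S := insert z R with hSdef
  have hd := hg.1
  have hSccl : Closed π Sᶜ := hd.closed_compl hScl
  set j := π z with hjdef
  have hjz : j < z := lt_of_le_of_ne (hz j) (hd z).2
  refine ⟨hd.restr hSccl, fun J hJc hJcl => ?_⟩
  by_contra hJ
  rw [not_or] at hJ
  obtain ⟨hJ0, hJ1⟩ := hJ
  set J' : Finset α := J.map (Function.Embedding.subtype _) with hJ'
  have memJ' : ∀ {t : α}, t ∈ J' ↔ ∃ h : t ∈ Sᶜ, (⟨t, h⟩ : ↥(Sᶜ)) ∈ J := fun {t} => by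
    rw [hJ', Finset.mem_map]
    constructor
    · rintro ⟨⟨t', ht'⟩, hJt, rfl⟩; exact ⟨ht', hJt⟩
    · rintro ⟨ht, hJt⟩; exact ⟨⟨t, ht⟩, hJt, rfl⟩
  have hJ'S : ∀ {t : α}, t ∈ J' → t ∉ S := fun ht => Finset.mem_compl.1 (memJ'.1 ht).1
  have notS : ∀ {t : α}, t ∉ S ↔ t ≠ z ∧ t ∉ R := fun {t} => by rw [hSdef, Finset.mem_insert, not_or]
  have hJ'cl : Closed π J' := fun t ht => by
    obtain ⟨hts, hJt⟩ := memJ'.1 ht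
    have := hJcl hJt
    have hv : ((restr π Sᶜ ⟨t, hts⟩ : ↥(Sᶜ)) : α) = π t := restr_val hSccl _
    exact memJ'.2 ⟨hv ▸ (restr π Sᶜ ⟨t, hts⟩).2, by convert this using 1; exact Subtype.ext hv.symm⟩
  -- convexity transfer: an `α`-interval between two points of `J'` all of whose points avoid `S` lies in `J'`
  have conv : ∀ {x y t : α}, x ∈ J' → y ∈ J' → x ≤ t → t ≤ y → t ∉ S → t ∈ J' := fun {x y t} hx hy hxt hty hts => by
    obtain ⟨hxS, hxJ⟩ := memJ'.1 hx
    obtain ⟨hyS, hyJ⟩ := memJ'.1 hy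
    have htS := Finset.mem_compl.2 hts
    exact memJ'.2 ⟨htS, hJc hxJ hyJ (show (⟨x, hxS⟩ : ↥(Sᶜ)) ≤ ⟨t, htS⟩ from hxt)
      (show (⟨t, htS⟩ : ↥(Sᶜ)) ≤ ⟨y, hyS⟩ from hty)⟩
  -- `J'` non-empty and not all of `Sᶜ`
  obtain ⟨⟨s₀, hs₀S⟩, hs₀⟩ := Finset.nonempty_iff_ne_empty.2 hJ0
  have hs₀J' : s₀ ∈ J' := memJ'.2 ⟨hs₀S, hs₀⟩
  obtain ⟨⟨s₁, hs₁S⟩, hs₁⟩ : ∃ s : ↥(Sᶜ), s ∉ J := by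
    by_contra h; push Not at h
    exact hJ1 (Finset.eq_univ_iff_forall.2 h)
  have hs₁J' : s₁ ∉ J' := fun h => by obtain ⟨_, h⟩ := memJ'.1 h; exact hs₁ h
  have hzJ' : z ∉ J' := fun h => (notS.1 (hJ'S h)).1 rfl
  -- a proper non-empty convex closed `α`-block contradicts irreducibility
  have absurd_block : ∀ C : Finset α, Convex C → Closed π C → (∃ t, t ∈ C) → (∃ t, t ∉ C) → False := by
    rintro C hCc hCcl ⟨t, ht⟩ ⟨t', ht'⟩
    rcases hg.2 C hCc hCcl with h0 | h1
    · rw [h0] at ht; exact Finset.notMem_empty _ ht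
    · exact ht' (Finset.eq_univ_iff_forall.1 h1 _)
  by_cases hlow : ∀ x ∈ J', x < j
  · -- (i) all of `J'` below `j`: `J'` is a block of `π`
    refine absurd_block J' (fun x hx y hy t hxt hty => conv hx hy hxt hty (notS.2 ⟨?_, fun htR => ?_⟩)) hJ'cl ⟨s₀, hs₀J'⟩ ⟨z, hzJ'⟩
    · exact ((hty.trans_lt (hlow y hy)).trans hjz).ne
    · exact (notS.1 (hJ'S hy)).2 (hRc htR hjR hty (hlow y hy).le)
  by_cases hhigh : ∀ x ∈ J', j < x
  · -- (ii) all of `J'` above `j`: `J'` is a block of `π`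
    refine absurd_block J' (fun x hx y hy t hxt hty => conv hx hy hxt hty (notS.2 ⟨?_, fun htR => ?_⟩)) hJ'cl ⟨s₀, hs₀J'⟩ ⟨z, hzJ'⟩
    · intro htz
      have hyz : y = z := le_antisymm (hz y) (htz ▸ hty)
      exact hzJ' (hyz ▸ hy)
    · exact (notS.1 (hJ'S hx)).2 (hRc hjR htR (hhigh x hx).le hxt)
  -- (iii) `J'` has points on both sides of `j`: `T = J' ∪ R` is a larger candidate unless it touches the ends
  push Not at hlow hhigh
  obtain ⟨y₀, hy₀, hjy₀⟩ := hlow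
  obtain ⟨x₀, hx₀, hx₀j⟩ := hhigh
  have hx₀j : x₀ < j := lt_of_le_of_ne hx₀j fun h => (notS.1 (hJ'S hx₀)).2 (by rw [h]; exact hjR)
  have hjy₀ : j < y₀ := lt_of_le_of_ne hjy₀ fun h => (notS.1 (hJ'S hy₀)).2 (by rw [← h]; exact hjR)
  set T : Finset α := J' ∪ R with hT
  have memT : ∀ {t : α}, t ∈ T ↔ t ∈ J' ∨ t ∈ R := fun {t} => by rw [hT, Finset.mem_union]
  have hzT : z ∉ T := fun h => by
    rcases memT.1 h with h | h
    · exact hzJ' h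
    · exact hzR h
  have hjT : j ∈ T := memT.2 (Or.inr hjR)
  have hTc : Convex T := by
    intro s₁' hs₁' s₂' hs₂' t h1t ht2
    by_cases htR : t ∈ R
    · exact memT.2 (Or.inr htR)
    have htz : t ≠ z := by
      intro htz
      have : s₂' = z := le_antisymm (hz _) (htz ▸ ht2)
      exact hzT (this ▸ hs₂')
    have hts : t ∉ S := notS.2 ⟨htz, htR⟩
    -- lower and upper witnesses in `J'`
    have lower : ∃ l ∈ J', l ≤ t := by
      rcases memT.1 hs₁' with h | h
      · exact ⟨s₁', h, h1t⟩
      · refine ⟨x₀, hx₀, (hx₀j.trans ?_).le⟩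
        by_contra hjt'; push Not at hjt'
        exact htR (hRc h hjR h1t hjt')
    have upper : ∃ u' ∈ J', t ≤ u' := by
      rcases memT.1 hs₂' with h | h
      · exact ⟨s₂', h, ht2⟩
      · refine ⟨y₀, hy₀, (?_ : t < y₀).le⟩
        refine lt_of_lt_of_le ?_ hjy₀.le
        by_contra hjt'; push Not at hjt'
        exact htR (hRc hjR h hjt' ht2)
    obtain ⟨l, hl, hlt⟩ := lower
    obtain ⟨u', hu', htu'⟩ := upper
    exact memT.2 (Or.inl (conv hl hu' hlt htu' hts))
  have hTcl : Closed π (insert z T) := by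
    intro t ht
    rw [Finset.mem_insert] at ht ⊢
    rcases ht with rfl | ht
    · exact Or.inr hjT
    · rcases memT.1 ht with ht | ht
      · exact Or.inr (memT.2 (Or.inl (hJ'cl ht)))
      · have := hScl (Finset.mem_insert_of_mem ht)
        rw [hSdef, Finset.mem_insert] at this
        rcases this with h | h
        · exact Or.inl h
        · exact Or.inr (memT.2 (Or.inr h))
  -- the outer complement `C = Sᶜ ∖ J'`, a closed set, non-empty and missing `z`
  set C : Finset α := Sᶜ \ J' with hC
  have hCcl : Closed π C := hd.closed_sdiff hSccl hJ'cl
  have memC : ∀ {t : α}, t ∈ C ↔ t ∉ S ∧ t ∉ J' := fun {t} => by rw [hC, Finset.mem_sdiff, Finset.mem_compl]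
  have hs₁C : s₁ ∈ C := memC.2 ⟨Finset.mem_compl.1 hs₁S, hs₁J'⟩
  have hzC : z ∉ C := fun h => (memC.1 h).1 (Finset.mem_insert_self z R)
  have notT_of_C : ∀ {t : α}, t ∈ C → t ∉ T := fun {t} ht h => by
    rcases memT.1 h with h | h
    · exact (memC.1 ht).2 h
    · exact (notS.1 (memC.1 ht).1).2 h
  by_cases hbT : b ∈ T
  · -- `T` touches the bottom: it is a lower set, and `C` is the convex block above it
    have hTlow : ∀ {s w : α}, s ∈ T → w ≤ s → w ∈ T := fun {s w} hs hws => hTc hbT hs (hb w) hws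
    refine absurd_block C (fun x hx y hy t hxt hty => memC.2 ⟨notS.2 ⟨?_, ?_⟩, ?_⟩) hCcl ⟨s₁, hs₁C⟩ ⟨z, hzC⟩
    · intro htz
      have : y = z := le_antisymm (hz y) (htz ▸ hty)
      exact hzC (this ▸ hy)
    · exact fun htR => notT_of_C hx (hTlow (memT.2 (Or.inr htR)) hxt)
    · exact fun htJ => notT_of_C hx (hTlow (memT.2 (Or.inl htJ)) hxt)
  by_cases hup : ∃ u', u' ∉ T ∧ u' ≠ z ∧ ∀ r ∈ T, r < u'
  · -- `T` is a candidate strictly larger than `R = rmax`: contradiction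
    have hTcand : IsCand π b z T :=
      ⟨⟨⟨j, hjT⟩, hTc, hzT, hbT, hup⟩, hjT, hTcl⟩
    have hTR : T ⊆ R := subset_rmax hTcand
    exact (notS.1 (hJ'S hs₀J')).2 (hTR (memT.2 (Or.inl hs₀J')))
  · -- no non-top point above `T`: `T ∪ {z}` is an upper set, and `C` is the convex block below it
    push Not at hup
    have hTup : ∀ {w : α}, w ∉ T → w ≠ z → ∀ s ∈ T, w < s := by
      intro w hwT hwz s hs
      obtain ⟨r, hr, hwr⟩ := hup w hwT hwz
      rcases lt_or_ge w s with h | h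
      · exact h
      · exact absurd (hTc hs hr h hwr) hwT
    refine absurd_block C (fun x hx y hy t hxt hty => ?_) hCcl ⟨s₁, hs₁C⟩ ⟨z, hzC⟩
    have hyz : y ≠ z := fun h => hzC (h ▸ hy)
    have hty' : ∀ s ∈ T, t < s := fun s hs => lt_of_le_of_lt hty (hTup (notT_of_C hy) hyz s hs)
    have htT : t ∉ T := fun h => lt_irrefl t (hty' t h)
    refine memC.2 ⟨notS.2 ⟨?_, fun h => htT (memT.2 (Or.inr h))⟩, fun h => htT (memT.2 (Or.inl h))⟩
    exact (lt_of_le_of_lt hty (lt_of_le_of_ne (hz y) hyz)).ne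

end Top

/-- **The largest candidate of a glued diagram is the shape glued along** (outer part irreducible). [folklore] -/
theorem rmax_glue {b z : α} {R : Finset α} (hR : IsShape b z R) (hb : ∀ x, b ≤ x) (hz : ∀ x, x ≤ z)
    {πA : ↥((insert z R)ᶜ) → ↥((insert z R)ᶜ)} {πB : ↥(insert z R) → ↥(insert z R)}
    (hA : IsGood πA) (hB : IsDiag πB) : rmax (glue (insert z R) πA πB) b z = R := by
  have hd : IsDiag (glue (insert z R) πA πB) := hA.1.glue hB
  have hR' := hR
  obtain ⟨⟨r₀, hr₀⟩, hRc, hzR, hbR, u, huR, huz, hu⟩ := hR'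
  have notS : ∀ {t : α}, t ∉ insert z R ↔ t ≠ z ∧ t ∉ R := fun {t} => by rw [Finset.mem_insert, not_or]
  have hbz : b ≠ z := fun hbz => huz (le_antisymm (hz u) (by rw [← hbz]; exact hb u))
  have hbS : b ∈ (insert z R)ᶜ := Finset.mem_compl.2 (notS.2 ⟨hbz, hbR⟩)
  -- `R` is a candidate of the glued diagram
  have hjR : glue (insert z R) πA πB z ∈ R := by
    have hzS : z ∈ insert z R := Finset.mem_insert_self z R
    have h1 : glue (insert z R) πA πB z = πB ⟨z, hzS⟩ := glue_apply_mem hzS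
    have h2 : (πB ⟨z, hzS⟩ : α) ∈ insert z R := (πB ⟨z, hzS⟩).2
    have h3 : (πB ⟨z, hzS⟩ : α) ≠ z := fun h =>
      (hB ⟨z, hzS⟩).2 (Subtype.ext (by rw [h]))
    rw [h1]
    exact (Finset.mem_insert.1 h2).resolve_left h3
  have hRcand : IsCand (glue (insert z R) πA πB) b z R := ⟨hR, hjR, closed_glue⟩
  -- every candidate is inside `R`
  have hsub : ∀ R'' : Finset α, IsCand (glue (insert z R) πA πB) b z R'' → R'' ⊆ R := by
    rintro R'' ⟨⟨-, hc'', hz'', hb'', -⟩, hj'', hcl''⟩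
    by_contra hnot
    obtain ⟨x, hxR'', hxR⟩ := Finset.not_subset.1 hnot
    -- the block `D = R'' ∖ R` of the outer part
    set D : Finset ↥((insert z R)ᶜ) := Finset.univ.filter fun y => (y : α) ∈ R'' ∧ (y : α) ∉ R with hD
    have memD : ∀ {y : ↥((insert z R)ᶜ)}, y ∈ D ↔ (y : α) ∈ R'' ∧ (y : α) ∉ R := fun {y} => by simp [hD]
    have hxS : x ∈ (insert z R)ᶜ := Finset.mem_compl.2 (notS.2 ⟨fun h => hz'' (by rw [← h]; exact hxR''), hxR⟩)
    have hDc : Convex D := by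
      -- `R ∪ R''` is convex
      have hU : Convex (R ∪ R'') := hRc.union hc'' hjR hj''
      intro x' hx' y' hy' t hxt hty
      obtain ⟨hx1, -⟩ := memD.1 hx'
      obtain ⟨hy1, -⟩ := memD.1 hy'
      have ht : (t : α) ∈ R ∪ R'' :=
        hU (Finset.mem_union_right _ hx1) (Finset.mem_union_right _ hy1) (show (x' : α) ≤ t from hxt)
          (show (t : α) ≤ y' from hty)
      have htR : (t : α) ∉ R := (notS.1 (Finset.mem_compl.1 t.2)).2
      exact memD.2 ⟨(Finset.mem_union.1 ht).resolve_left htR, htR⟩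
    have hDcl : Closed πA D := by
      intro y hy
      obtain ⟨hy1, hy2⟩ := memD.1 hy
      have hv : ((πA y : ↥((insert z R)ᶜ)) : α) = glue (insert z R) πA πB y := (glue_coe_compl y).symm
      have hπy : glue (insert z R) πA πB y ∈ insert z R'' := hcl'' (Finset.mem_insert_of_mem hy1)
      rw [Finset.mem_insert] at hπy
      refine memD.2 ⟨?_, (notS.1 (Finset.mem_compl.1 (πA y).2)).2⟩
      rw [hv]
      refine hπy.resolve_left fun h => hy2 ?_
      have : (y : α) = glue (insert z R) πA πB z := by
        have h2 := (hd y).1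
        rw [h] at h2
        exact h2.symm
      rw [this]; exact hjR
    rcases hA.2 D hDc hDcl with h0 | h1
    · have : (⟨x, hxS⟩ : ↥((insert z R)ᶜ)) ∈ D := memD.2 ⟨hxR'', hxR⟩
      rw [h0] at this; exact Finset.notMem_empty _ this
    · have : (⟨b, hbS⟩ : ↥((insert z R)ᶜ)) ∈ D := Finset.eq_univ_iff_forall.1 h1 _
      exact hb'' (memD.1 this).1
  -- hence `rmax = R`
  apply le_antisymm
  · exact Finset.sup_le fun R'' hR'' => hsub R'' (mem_candSet.1 hR'')
  · exact subset_rmax hRcand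

/-! ### The fibre count -/

/-- **Decomposition count**: the irreducible diagrams on `α` (at least three points, bottom `b`, top `z`) are in bijection with the triples
(shape `R`, irreducible diagram on `(R ∪ {z})ᶜ`, irreducible diagram on `R ∪ {z}`). [folklore] -/
theorem card_goodSet_eq_sum {b z : α} (hb : ∀ x, b ≤ x) (hz : ∀ x, x ≤ z) (h3 : 3 ≤ Fintype.card α) :
    (goodSet α).card = ∑ R ∈ shapeSet b z, (goodSet ↥((insert z R)ᶜ)).card * (goodSet ↥(insert z R)).card := by
  classical
  rw [Finset.card_eq_sum_card_fiberwise (f := fun π => rmax π b z) (t := shapeSet b z)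
    (fun π hπ => rmax_mem_shapeSet (mem_goodSet.1 hπ) hb hz h3)]
  refine Finset.sum_congr rfl fun R hR => ?_
  have hRs : IsShape b z R := mem_shapeSet.1 hR
  rw [← Finset.card_product]
  refine Finset.card_nbij' (fun π => (restr π (insert z R)ᶜ, restr π (insert z R)))
    (fun p => glue (insert z R) p.1 p.2) ?_ ?_ ?_ ?_
  · -- into
    intro π hπ
    rw [Finset.mem_coe, Finset.mem_filter] at hπ
    obtain ⟨hπ, hRπ⟩ := hπ
    have hg := mem_goodSet.1 hπ
    rw [Finset.mem_coe, Finset.mem_product, mem_goodSet, mem_goodSet, ← hRπ]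
    exact ⟨isGood_restr_compl_rmax hg hb hz h3, isGood_restr_rmax hg hb hz h3⟩
  · -- onto
    rintro ⟨πA, πB⟩ hp
    rw [Finset.mem_coe, Finset.mem_product, mem_goodSet, mem_goodSet] at hp
    rw [Finset.mem_coe, Finset.mem_filter, mem_goodSet]
    exact ⟨isGood_glue hp.1 hp.2 (hRs.not_convex_insert hz) (hRs.not_convex_compl hb hz), rmax_glue hRs hb hz hp.1 hp.2.1⟩
  · -- left inverse
    intro π hπ
    rw [Finset.mem_coe, Finset.mem_filter] at hπ
    obtain ⟨hπ, hRπ⟩ := hπ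
    have hg := mem_goodSet.1 hπ
    have hcl : Closed π (insert z R) := by rw [← hRπ]; exact (rmax_isCand hg hb hz h3).2.2
    exact glue_restr hg.1 hcl
  · -- right inverse
    rintro ⟨πA, πB⟩ -
    exact Prod.ext restr_glue_left restr_glue_right

end Summit.CriticalPhenomena.PercolationContinuityZ3.Theorems.Pcint.ChordDiag
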